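import Summits.FinalStateConjecture.FinalStateConjecture.Theses.ZeroEnergyKerrOrBomb
import Summits.FinalStateConjecture.FinalStateConjecture.Theorems.ZeroEnergyRigidity.Negative.StationaryFieldRescaling
import Literature.Geometry.Lorentzian.KillingModeStability

/-!
# `KerrOrBomb` (crux `stmt-FinalStateConjecture-10689`, route `ZeroEnergyKerrOrBomb`):
# the mode-stability hypothesis never sees the normalisation of the stationary field

Support file of the crux disprover (cdisprove seat `refuter-cdisprove-stmt-FinalStateConjecture-10689-0`,
cycle 1, 2026-08-16), `sorry`-free; workfile `Cruxes/KerrOrBomb/Disproof.lean` §2(c).  The landed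
sibling file `ZeroEnergyRigidity/Negative/StationaryFieldRescaling.lean` shows that
`StationaryRescale.rescale 𝓑 hc` (`T ↦ c • T`, `c > 0`) is again a `StationaryAFBlackHole` with the
same spacetime, slice, end, `M_ext`, d.o.c. and horizon.  Here: the Killing-mode pairs
(`StationaryAFBlackHole.IsKillingModePair`, `KillingModeStability.lean`) of the rescaled
presentation of frequency `c(ν + iω)` are exactly those of `𝓑` of frequency `ν + iω`
(`isKillingModePair_rescale_iff`: the eigen-equation is linear in `T`, the smoothness / wave /
boundedness clauses do not mention `T`), hence mode stability h6 is rescaling-invariant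
(`isKillingModeStable_rescale_iff`, `0 < ν ↔ 0 < cν`), and so is the whole instance of the crux
(`kerrOrBomb_instance_rescale_iff`: h1–h4 and the conclusion see only the metric, `M_ext`, `doc`,
`horizon`).  Consequence: the growth rate `ν` and frequency `ω` of a would-be bomb are defined only
up to a common positive factor unless `T` is normalised by data the structure does not carry
(`g(T,T) → −1` at infinity); statements about them must be scale-covariant (`ν/κ`, `ω/Ω_H`).

References: P. T. Chruściel, J. L. Costa, Astérisque 321 (2008), §2.1–2.2; Y. Shlapentokh-Rothman,
AHP 16 (2015) 289, Def. 1.1.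
-/

noncomputable section

set_option linter.dupNamespace false
set_option maxSynthPendingDepth 3

namespace Summit.FinalStateConjecture.FinalStateConjecture.Theorems.KerrOrBomb.Negative

open Set Literature.Geometry.Lorentzian
open scoped Manifold Topology
open Summit.FinalStateConjecture.FinalStateConjecture.Theorems.ZeroEnergyRigidity.Negative.StationaryRescale

variable (𝓑 : StationaryAFBlackHole.{0}) [𝓑.metric.HasLeviCivita] {c : ℝ} (hc : 0 < c)

/-- **Rescaling covariance of Killing-mode pairs**: the pairs of `rescale 𝓑 hc` of frequency
`c(ν + iω)` are the pairs of `𝓑` of frequency `ν + iω`. [cite: ChruscielCosta2008, §2.2 (2.2)] -/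
theorem isKillingModePair_rescale_iff {ν ω : ℝ} {ψ χ : 𝓑.carrier → ℝ} :
    (rescale 𝓑 hc).IsKillingModePair (c * ν) (c * ω) ψ χ ↔ 𝓑.IsKillingModePair ν ω ψ χ := by
  have hdoc : (rescale 𝓑 hc).doc = 𝓑.doc := rescale_doc 𝓑 hc
  have hhor : (rescale 𝓑 hc).horizon = 𝓑.horizon := rescale_horizon 𝓑 hc
  have key : ∀ (φ : 𝓑.carrier → ℝ) (x : 𝓑.carrier) (r : ℝ),
      (mfderiv (𝓡 4) 𝓘(ℝ, ℝ) φ x ((rescale 𝓑 hc).killing x) = c * r) ↔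
        (mfderiv (𝓡 4) 𝓘(ℝ, ℝ) φ x (𝓑.killing x) = r) := by
    intro φ x r
    have hlin : mfderiv (𝓡 4) 𝓘(ℝ, ℝ) φ x ((rescale 𝓑 hc).killing x) =
        c • mfderiv (𝓡 4) 𝓘(ℝ, ℝ) φ x (𝓑.killing x) := by
      rw [rescale_killing, Pi.smul_apply, ContinuousLinearMap.map_smul]
    rw [hlin]
    set dd : ℝ := mfderiv (𝓡 4) 𝓘(ℝ, ℝ) φ x (𝓑.killing x) with hdd
    show c * dd = c * r ↔ dd = r
    exact mul_right_inj' hc.ne'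
  unfold StationaryAFBlackHole.IsKillingModePair
  rw [hdoc, hhor]
  refine and_congr Iff.rfl (and_congr Iff.rfl (and_congr ?_ Iff.rfl))
  refine forall₂_congr fun x _ ↦ ?_
  have e1 : c * ν * ψ x - c * ω * χ x = c * (ν * ψ x - ω * χ x) := by ring
  have e2 : c * ω * ψ x + c * ν * χ x = c * (ω * ψ x + ν * χ x) := by ring
  exact and_congr (by rw [e1]; exact key ψ x _) (by rw [e2]; exact key χ x _)

/-- **Mode stability is invariant under rescaling of the stationary field.** [folklore] -/
theorem isKillingModeStable_rescale_iff :
    (rescale 𝓑 hc).IsKillingModeStable ↔ 𝓑.IsKillingModeStable := by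
  simp only [StationaryAFBlackHole.isKillingModeStable_iff_forall_isKillingModePair]
  have hdoc : (rescale 𝓑 hc).doc = 𝓑.doc := rescale_doc 𝓑 hc
  constructor
  · intro h ν ω ψ χ hν hp x hx
    have hp' : (rescale 𝓑 hc).IsKillingModePair (c * ν) (c * ω) ψ χ :=
      (isKillingModePair_rescale_iff 𝓑 hc).2 hp
    exact h (c * ν) (c * ω) ψ χ (mul_pos hc hν) hp' x (hdoc ▸ hx)
  · intro h ν ω ψ χ hν hp x hx
    have hp' : 𝓑.IsKillingModePair (c⁻¹ * ν) (c⁻¹ * ω) ψ χ := by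
      rw [← isKillingModePair_rescale_iff 𝓑 hc]
      simpa [← mul_assoc, mul_inv_cancel₀ hc.ne'] using hp
    exact h (c⁻¹ * ν) (c⁻¹ * ω) ψ χ (mul_pos (inv_pos.2 hc) hν) hp' x (hdoc ▸ hx)

/-- **The instance of `KerrOrBomb` at `rescale 𝓑 hc` is literally equivalent to the instance at
`𝓑`** (h1–h6 → conclusion, spelled as served): h1, h4 are statements about the unchanged metric,
h2/h3/conclusion see `horizon`/`M_ext`/`doc` (unchanged), h5 and h6 are invariant.  No proof of the
crux can extract a normalisation of `T` from its hypotheses. [folklore] -/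
theorem kerrOrBomb_instance_rescale_iff [Kerr.Facts] :
    ((rescale 𝓑 hc).metric.toPseudoRiemannianMetric.IsRicciFlat →
      IsConnected (rescale 𝓑 hc).horizon →
      (rescale 𝓑 hc).toSpacetime.IsNonDegenerateHorizon (rescale 𝓑 hc).Mext →
      (rescale 𝓑 hc).metric.IsGloballyHyperbolic (rescale 𝓑 hc).timeOrientation →
      (∀ p ∈ (rescale 𝓑 hc).doc, (rescale 𝓑 hc).killing p ≠ 0) →
      (rescale 𝓑 hc).IsKillingModeStable →
      ∃ (M a : ℝ), Kerr.IsSubextremal M a ∧ ∃ Ψ : Kerr.exterior M a → (rescale 𝓑 hc).carrier,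
        Function.Injective Ψ ∧ Set.range Ψ = (rescale 𝓑 hc).doc ∧
          PseudoRiemannianMetric.IsIsometricImmersion
            (Kerr.smoothMetric M a (Kerr.rPlus M a)).toPseudoRiemannianMetric
            (rescale 𝓑 hc).metric.toPseudoRiemannianMetric Ψ) ↔
    (𝓑.metric.toPseudoRiemannianMetric.IsRicciFlat → IsConnected 𝓑.horizon →
      𝓑.toSpacetime.IsNonDegenerateHorizon 𝓑.Mext →
      𝓑.metric.IsGloballyHyperbolic 𝓑.timeOrientation → (∀ p ∈ 𝓑.doc, 𝓑.killing p ≠ 0) →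
      𝓑.IsKillingModeStable →
      ∃ (M a : ℝ), Kerr.IsSubextremal M a ∧ ∃ Ψ : Kerr.exterior M a → 𝓑.carrier,
        Function.Injective Ψ ∧ Set.range Ψ = 𝓑.doc ∧
          PseudoRiemannianMetric.IsIsometricImmersion
            (Kerr.smoothMetric M a (Kerr.rPlus M a)).toPseudoRiemannianMetric
            𝓑.metric.toPseudoRiemannianMetric Ψ) := by
  have h2 : IsConnected (rescale 𝓑 hc).horizon ↔ IsConnected 𝓑.horizon := by
    rw [rescale_horizon]; exact Iff.rfl
  have h3 : (rescale 𝓑 hc).toSpacetime.IsNonDegenerateHorizon (rescale 𝓑 hc).Mext ↔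
      𝓑.toSpacetime.IsNonDegenerateHorizon 𝓑.Mext := by
    rw [rescale_Mext]; exact Iff.rfl
  have hK : (∃ (M a : ℝ), Kerr.IsSubextremal M a ∧ ∃ Ψ : Kerr.exterior M a → (rescale 𝓑 hc).carrier,
        Function.Injective Ψ ∧ Set.range Ψ = (rescale 𝓑 hc).doc ∧
          PseudoRiemannianMetric.IsIsometricImmersion
            (Kerr.smoothMetric M a (Kerr.rPlus M a)).toPseudoRiemannianMetric
            (rescale 𝓑 hc).metric.toPseudoRiemannianMetric Ψ) ↔
      (∃ (M a : ℝ), Kerr.IsSubextremal M a ∧ ∃ Ψ : Kerr.exterior M a → 𝓑.carrier,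
        Function.Injective Ψ ∧ Set.range Ψ = 𝓑.doc ∧
          PseudoRiemannianMetric.IsIsometricImmersion
            (Kerr.smoothMetric M a (Kerr.rPlus M a)).toPseudoRiemannianMetric
            𝓑.metric.toPseudoRiemannianMetric Ψ) := by
    rw [rescale_doc]; exact Iff.rfl
  exact imp_congr Iff.rfl (imp_congr h2 (imp_congr h3 (imp_congr Iff.rfl
    (imp_congr (rescale_killing_ne_zero_iff 𝓑 hc)
      (imp_congr (isKillingModeStable_rescale_iff 𝓑 hc) hK)))))

end Summit.FinalStateConjecture.FinalStateConjecture.Theorems.KerrOrBomb.Negative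

end
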